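import Summits.CriticalPhenomena.CardyFormulaZ2.Theorems.CardyComplexConeSLESixFamiliesGiveCardyCollarDomainsPart4
import Summits.CriticalPhenomena.CardyFormulaZ2.Theorems.CardyComplexConeSLESixFamiliesGiveCardyDefs

/-!
# The upper comparison rectangle: geometry and closeness (helper file 5 for `stub_collarDomains`)

Route `CardyComplexCone`, crux `SLESixFamiliesGiveCardy`, line `collar-touch-sandwich`, STUB E.
For the upper comparison rectangle `Q = S.upperRect hta htb = (Ω₁; a⁺, b⁺, c′, d′)` of a collar set-up
`S : CollarSetup R ε` (`Part4`): `UpperCollarGeom R (Q.chord 0 1) (Q.arc 2)` (`upperCollarGeom`) and the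
closeness of its re-based boundary loop and marks to those of `R` (`upper_close`).
-/

noncomputable section

open Set Metric Topology Filter
open Literature.Probability.RandomPlanarGeometry

namespace Summit.CriticalPhenomena.CardyFormulaZ2.Cruxes.SLESixFamiliesGiveCardy.CollarTouchSandwich

namespace CollarSetup

variable {R : ConformalRectangle} {ε : ℝ} (S : CollarSetup R ε)

/-- The margin is below `1/4`. -/
theorem δ_lt : S.δ < 1 / 4 := by
  have := S.gap₀; have := (R.mark_mem 1).2; have := (R.mark_mem 0).1; linarith

/-- The windows of the upper rectangle, unfolded. -/
theorem upperW_eq : S.upperW.m = R.mark 0 ∧ S.upperW.a₁ = R.mark 1 + S.δ ∧ S.upperW.b₁ = R.mark 2 - S.δ ∧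
    S.upperW.a₂ = R.mark 3 + S.δ ∧ S.upperW.b₂ = R.mark 0 + 1 - S.δ ∧ S.upperW.d = S.δ := ⟨rfl, rfl, rfl, rfl, rfl, rfl⟩

/-- **The upper profile is `1` on `[m₀ - δ, m₁ + δ]`** (around the arc `(ab)`). -/
theorem upperP_eq_one₀ {t : ℝ} (ht : t ∈ Icc (R.mark 0 - S.δ) (R.mark 1 + S.δ)) : S.upperP.p t = 1 := by
  obtain ⟨hm0, hm01, hm12, hm23, hm30⟩ := R.marks_chain
  have hδ := S.δ_pos; have hδ1 := S.δ_lt; have hg1 := S.gap₁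
  obtain ⟨em, ea₁, eb₁, ea₂, eb₂, -⟩ := S.upperW_eq
  rw [upperP, S.upperW.profile_eq_one_iff, ea₁, eb₁, ea₂, eb₂]
  rcases lt_or_ge t (R.mark 0) with h0 | h0
  · rw [S.upperW.rep_of_mem_sub_one ⟨by rw [em]; linarith [ht.1], by rw [em]; exact h0⟩]
    exact ⟨fun h => by linarith [h.2, ht.1], fun h => by linarith [h.2, ht.1]⟩
  · rw [S.upperW.rep_of_mem ⟨by rw [em]; exact h0, by rw [em]; linarith [ht.2]⟩]
    exact ⟨fun h => by linarith [h.1, ht.2], fun h => by linarith [h.1, ht.2]⟩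

/-- **The upper profile is `1` on `[m₂ - δ, m₃ + δ]`** (around the arc `(cd)`). -/
theorem upperP_eq_one₂ {t : ℝ} (ht : t ∈ Icc (R.mark 2 - S.δ) (R.mark 3 + S.δ)) : S.upperP.p t = 1 := by
  obtain ⟨hm0, hm01, hm12, hm23, hm30⟩ := R.marks_chain
  have hδ := S.δ_pos; have hg1 := S.gap₁; have hg3 := S.gap₃
  obtain ⟨em, ea₁, eb₁, ea₂, eb₂, -⟩ := S.upperW_eq
  rw [upperP, S.upperW.profile_eq_one_iff, ea₁, eb₁, ea₂, eb₂,
    S.upperW.rep_of_mem ⟨by rw [em]; linarith [ht.1], by rw [em]; linarith [ht.2]⟩]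
  exact ⟨fun h => by linarith [h.2, ht.1], fun h => by linarith [h.1, ht.2]⟩

variable {t_a t_b : ℝ} (hta : t_a ∈ Icc (R.mark 0 + 1 - 3 * S.δ) (R.mark 0 + 1 - 2 * S.δ))
  (htb : t_b ∈ Icc (R.mark 1 + 2 * S.δ) (R.mark 1 + 3 * S.δ))
include hta htb

/-- The representatives of the collar mark parameters lie in the open windows. -/
theorem upper_rep_marks : S.upperW.rep (t_a - 1) ∈ Ioo S.upperW.a₂ S.upperW.b₂ ∧ S.upperW.rep t_b ∈ Ioo S.upperW.a₁ S.upperW.b₁ := by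
  obtain ⟨hm0, hm01, hm12, hm23, hm30⟩ := R.marks_chain
  have hδ := S.δ_pos; have hg1 := S.gap₁; have hg3 := S.gap₃
  obtain ⟨em, ea₁, eb₁, ea₂, eb₂, -⟩ := S.upperW_eq
  rw [ea₁, eb₁, ea₂, eb₂, S.upperW.rep_of_mem_sub_one ⟨by rw [em]; linarith [hta.1], by rw [em]; linarith [hta.2]⟩,
    S.upperW.rep_of_mem ⟨by rw [em]; linarith [htb.1], by rw [em]; linarith [htb.2]⟩, sub_add_cancel]
  exact ⟨⟨by linarith [hta.1], by linarith [hta.2]⟩, by linarith [htb.1], by linarith [htb.2]⟩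

/-- A parameter of the dual arc `[t_b, t_a]` whose loop point lies in `closure Ω` is in `[m₂ - δ, m₃ + δ]`. -/
theorem upper_mem_Icc_of_closure {t : ℝ} (ht : t ∈ Icc t_b t_a)
    (hcl : profileLoop S.T S.upperP.p t ∈ closure R.carrier) : t ∈ Icc (R.mark 2 - S.δ) (R.mark 3 + S.δ) := by
  obtain ⟨hm0, hm01, hm12, hm23, hm30⟩ := R.marks_chain
  have hδ := S.δ_pos
  obtain ⟨em, ea₁, eb₁, ea₂, eb₂, -⟩ := S.upperW_eq
  obtain ⟨h1, h2⟩ := profile_eq_one_of_mem_closure R S.T S.upperW S.h_pos S.h_le_half hcl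
  rw [S.upperW.rep_of_mem ⟨by rw [em]; linarith [htb.1, ht.1], by rw [em]; linarith [hta.2, ht.2]⟩] at h1 h2
  rw [ea₁, eb₁, mem_Ioo, not_and_or, not_lt, not_lt] at h1
  rw [ea₂, eb₂, mem_Ioo, not_and_or, not_lt, not_lt] at h2
  exact ⟨h1.resolve_left (by intro h; linarith [htb.1, ht.1]), h2.resolve_right (by intro h; linarith [hta.2, ht.2])⟩

/-- **Geometry of the upper readout.** -/
theorem upperCollarGeom :
    UpperCollarGeom R ((S.upperRect hta htb).chord 0 1 (by decide)) ((S.upperRect hta htb).arc 2) := by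
  obtain ⟨hm0, hm01, hm12, hm23, hm30⟩ := R.marks_chain
  have hδ := S.δ_pos; have hg1 := S.gap₁; have hg3 := S.gap₃
  obtain ⟨-, n1, n2, n3⟩ := R.nextMarks_eq
  obtain ⟨hA0, hA1, hG, hp0, hp1⟩ := S.upper_arcs hta htb
  have hh1 : S.h < 1 := by linarith [S.h_le]
  set L := profileLoop S.T S.upperP.p with hL
  -- loop = boundary on the two flat ranges
  have hflat₀ : ∀ t ∈ Icc (R.mark 0 - S.δ) (R.mark 1 + S.δ), L t = R.boundary t := fun t ht =>
    profileLoop_eq_boundary R S.T S.upperW S.h_pos S.h_le_half (S.upperP_eq_one₀ ht)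
  have hflat₂ : ∀ t ∈ Icc (R.mark 2 - S.δ) (R.mark 3 + S.δ), L t = R.boundary t := fun t ht =>
    profileLoop_eq_boundary R S.T S.upperW S.h_pos S.h_le_half (S.upperP_eq_one₂ ht)
  -- the arcs `(ab)`, `(cd)` of `R`
  have harc0 : R.arc 0 = R.boundary '' Icc (R.mark 0) (R.mark 1) := by
    rw [MarkedDomain.arc, R.nextMark_of_lt 0 (by decide)]; rfl
  have harc2 : R.arc 2 = R.boundary '' Icc (R.mark 2) (R.mark 3) := by rw [MarkedDomain.arc, n2]
  refine ⟨?_, ?_, ?_, ?_, ?_, ?_, ?_⟩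
  · -- `Ω ⊆ Ω₁`
    exact carrier_subset_profileDomain S.T S.upperP (S.hclose S.upperP rfl) (S.upperW.one_le_profile _ _)
  · -- `(cd) ⊆ G`
    rw [hG, harc2]
    rintro _ ⟨t, ht, rfl⟩
    have ht' : t ∈ Icc (R.mark 2 - S.δ) (R.mark 3 + S.δ) := ⟨by linarith [ht.1], by linarith [ht.2]⟩
    exact ⟨t, ht', hflat₂ t ht'⟩
  · -- dual arc ∩ closure Ω ⊆ G
    rw [hA1, hG]
    rintro _ ⟨⟨t, ht, rfl⟩, hcl⟩
    exact ⟨t, S.upper_mem_Icc_of_closure hta htb ht hcl, rfl⟩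
  · -- marks off `closure Ω`
    obtain ⟨ra, rb⟩ := S.upper_rep_marks hta htb
    intro i
    match i with
    | 0 => rw [hp0]; exact profileLoop_not_mem_closure R S.T S.upperW S.h_pos S.h_le_half (Or.inr ra)
    | 1 => rw [hp1]; exact profileLoop_not_mem_closure R S.T S.upperW S.h_pos S.h_le_half (Or.inl rb)
  · -- frontier points near `(ab)` are on the wired arc
    obtain ⟨r, hr, hfar⟩ := exists_pos_le_infDist (isCompact_Icc.image R.continuous_boundary) (R.isClosed_arc 0)
      ⟨_, R.pt_mem_arc_self 0⟩ (by rw [harc0]; exact (disjoint_image_Icc R (u := R.mark 0) (v := R.mark 1)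
        (c := R.mark 1 + S.δ) (d := R.mark 0 - S.δ + 1) (by linarith) (by linarith)).symm)
    refine ⟨r, hr, fun z hz hzr => ?_⟩
    rcases frontier_subset_union R (R.mark 0 - S.δ) (R.mark 1 + S.δ) hz with ⟨t, ht, rfl⟩ | hK
    · rw [hA0]
      exact ⟨t, ⟨by linarith [ht.1, hta.2], by linarith [ht.2, htb.1]⟩, hflat₀ t ht⟩
    · exact absurd hzr (not_lt.2 (hfar z hK))
  · -- frontier points near `(cd)` are on the dual arc
    obtain ⟨r, hr, hfar⟩ := exists_pos_le_infDist (isCompact_Icc.image R.continuous_boundary) (R.isClosed_arc 2)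
      ⟨_, R.pt_mem_arc_self 2⟩ (by rw [harc2]; exact (disjoint_image_Icc R (u := R.mark 2) (v := R.mark 3)
        (c := R.mark 3 + S.δ) (d := R.mark 2 - S.δ + 1) (by linarith) (by linarith)).symm)
    refine ⟨r, hr, fun z hz hzr => ?_⟩
    rcases frontier_subset_union R (R.mark 2 - S.δ) (R.mark 3 + S.δ) hz with ⟨t, ht, rfl⟩ | hK
    · rw [hA1]
      exact ⟨t, ⟨by linarith [ht.1, htb.2], by linarith [ht.2, hta.1]⟩, hflat₂ t ht⟩
    · exact absurd hzr (not_lt.2 (hfar z hK))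
  · -- the collars keep off `(ab)` and `(cd)`
    obtain ⟨em, ea₁, eb₁, ea₂, eb₂, -⟩ := S.upperW_eq
    have hK : IsCompact (collarPiece R S.T S.h S.upperW.a₁ S.upperW.b₁ ∪ collarPiece R S.T S.h S.upperW.a₂ S.upperW.b₂) :=
      (isCompact_collarPiece R S.T hh1 _ _).union (isCompact_collarPiece R S.T hh1 _ _)
    have hsub₁ : Icc S.upperW.a₁ S.upperW.b₁ ⊆ Ioo (R.mark 1) (R.nextMark 1) := by
      rw [ea₁, eb₁, n1]; exact fun t ht => ⟨by linarith [ht.1], by linarith [ht.2]⟩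
    have hsub₂ : Icc S.upperW.a₂ S.upperW.b₂ ⊆ Ioo (R.mark 3) (R.nextMark 3) := by
      rw [ea₂, eb₂, n3]; exact fun t ht => ⟨by linarith [ht.1], by linarith [ht.2]⟩
    have hdisj : ∀ j : Fin 4, j ≠ 1 → j ≠ 3 →
        Disjoint (collarPiece R S.T S.h S.upperW.a₁ S.upperW.b₁ ∪ collarPiece R S.T S.h S.upperW.a₂ S.upperW.b₂) (R.arc j) :=
      fun j hj1 hj3 => disjoint_union_left.2 ⟨disjoint_collarPiece_arc R S.T hh1 hj1 hsub₁, disjoint_collarPiece_arc R S.T hh1 hj3 hsub₂⟩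
    obtain ⟨r₀, hr₀, hfar₀⟩ := exists_pos_le_infDist hK (R.isClosed_arc 0) ⟨_, R.pt_mem_arc_self 0⟩ (hdisj 0 (by decide) (by decide))
    obtain ⟨r₂, hr₂, hfar₂⟩ := exists_pos_le_infDist hK (R.isClosed_arc 2) ⟨_, R.pt_mem_arc_self 2⟩ (hdisj 2 (by decide) (by decide))
    refine ⟨min r₀ r₂, lt_min hr₀ hr₂, fun z hz hzΩ => ?_⟩
    have hmem := mem_collarPiece_union R S.T S.upperW S.h_pos S.h_le_half hz (fun h => hzΩ (subset_closure h)) (Or.inr hzΩ)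
    exact ⟨(min_le_left _ _).trans (hfar₀ z hmem), (min_le_right _ _).trans (hfar₂ z hmem)⟩

/-- **Closeness of the upper rectangle to `R`**: the re-based loop is uniformly `ε`-close and the marks
are `ε`-close after the shift `c = t_a - 1`. -/
theorem upper_close : (∀ s : ℝ, dist ((S.upperRect hta htb).boundary s) (R.boundary (s + (t_a - 1))) ≤ ε) ∧
    ∀ i : Fin 4, |(S.upperRect hta htb).mark i + (t_a - 1) - R.mark i| ≤ ε := by
  have hδ := S.δ_pos; have hδε := S.δ_le
  constructor
  · intro s
    rw [boundary_upperRect, profileLoop]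
    have h1 := S.upperP.lower (s + (t_a - 1)); have h2 := S.upperP.upper (s + (t_a - 1))
    exact (S.dist_lt_ε _ h1 h2).le
  · obtain ⟨e0, e1, e2, e3⟩ := S.upperM_τ hta htb
    intro i
    rw [mark_upperRect_add]
    fin_cases i
    · simp only [Fin.zero_eta, Fin.isValue, e0]; rw [abs_le]; constructor <;> linarith [hta.1, hta.2]
    · simp only [Fin.mk_one, Fin.isValue, e1]; rw [abs_le]; constructor <;> linarith [htb.1, htb.2]
    · simp only [Fin.reduceFinMk, Fin.isValue, e2]; rw [abs_le]; constructor <;> linarith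
    · simp only [Fin.reduceFinMk, Fin.isValue, e3]; rw [abs_le]; constructor <;> linarith

end CollarSetup

/-- **Main statement of this file** (registered helper stub, arrow style): the upper comparison rectangle
has the upper readout geometry and is `ε`-close to `R`. -/
theorem upperRect_spec : ∀ {R : ConformalRectangle} {ε : ℝ} (S : CollarSetup R ε) {t_a t_b : ℝ} (hta : t_a ∈ Icc (R.mark 0 + 1 - 3 * S.δ) (R.mark 0 + 1 - 2 * S.δ)) (htb : t_b ∈ Icc (R.mark 1 + 2 * S.δ) (R.mark 1 + 3 * S.δ)), UpperCollarGeom R ((S.upperRect hta htb).chord 0 1 (by decide)) ((S.upperRect hta htb).arc 2) ∧ (∀ s : ℝ, dist ((S.upperRect hta htb).boundary s) (R.boundary (s + (t_a - 1))) ≤ ε) ∧ ∀ i : Fin 4, |(S.upperRect hta htb).mark i + (t_a - 1) - R.mark i| ≤ ε :=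
  fun S _ _ hta htb => ⟨S.upperCollarGeom hta htb, S.upper_close hta htb⟩

end Summit.CriticalPhenomena.CardyFormulaZ2.Cruxes.SLESixFamiliesGiveCardy.CollarTouchSandwich

end
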